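import Summits.QuantumFields.YangMills.Theorems.BalabanUVNodesN07SplitClauseHeadAtCubeDomains
import Summits.QuantumFields.YangMills.Theorems.BalabanUVNodesN07DatumGauge152Guarded
import Summits.QuantumFields.YangMills.Theorems.BalabanUVNodesN07LocalLettersCoreGuarded
import HarnessLib

/-!
# N07 [B11] (= [15] = [Balaban1985Variational]) Sect. F, road of record R0′, S6 HEAD: **THE KNIT — the guarded per-datum token `DatumGaugeSplitTopStepCoreG` CLOSED MODULO
# [6] Prop. 6 (N05's in-edge), the CHART LANE's per-datum deliverable `hchart`, and the BUDGET arithmetic**, AT THE PLAN's V20-G GUARD `c ≤ ν.M₁ ∧ k + c₀ ≤ F.m + K`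
# (the ∀-introduction over the record's data, the datums and S3's gauge: FILE 3 `localGaugeSplitOn_head159_cubeDomains_box` at every datum ∘ n07-w3 g7's guarded S3 door
# `datumGauge152_REfiner153_of_prop6P_guarded` ∘ `LocalGaugeSplitOn.of_le` to the token's threshold `Cδ_j + θε_j + Qε_j²`, `κ := b9OfP F Mc ρ B₁`)

Cell `pub-ymgap`, width seat `pub-ymgap-dag-n07-w4` g4 (sub-target S6 = the HEAD), CLAIM-5 ∕ INTENT-5 (cell bus).  `--kind proof --supports stmt-QuantumFields-27364 --as helper`
(K1⁹ per dag-lead KEY MAP v2); count-neutral; def-free.  [15] = [Balaban1985Variational]; [6] = [Balaban1985RegularSpaces]; [4] = [Balaban1984PropagatorsII].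

THE POINT.  dag-n07-w4 g3's guarded per-datum token `N07LocalLettersCoreGuarded.DatumGaugeSplitTopStepCoreG F N Sup Mc ρ Adm B₃ C θ Q κ a₀ a₁` (⇒ `LocalLettersSplitTopStepCoreG`
⇒ `HalvingStepTopCoreG` ⇒ k0-s1-w3's Core⇒Top link ⇒ `Prop8RegSepTopStepG` ⇒ stub 1) asks, for every admissible record datum `(ν, M, g, K, k, s)`, letters `ε δ`, data `W`, field
`U` with (17)∕(19), fibre and criticality, and every grid cube `(j, a)` meeting `Ω_j`: `LocalGaugeSplitOn (π '' box L (cornerP Mc ρ a) (sideP Mc ρ) j) η_j (κε_j) (Cδ_j + θε_j + Qε_j²) U`.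
FILE 4 delivers exactly this clause at one datum from [6] Prop. 6 (`hP6`), the chart side `hchart`, size letters and thresholds, under arithmetic side conditions.  THIS FILE is the
∀-INTRODUCTION: with `Sup := suppDomOfRecord` and the guard `Adm ν M g K k s :≡ M = Mc ∧ (44 + 4ρ + Mc + 3)·L ≤ ν.M₁ ∧ k ≤ K ∧ k + a′ + 3 ≤ m + K ∧ (∀ i ≤ k, Mc + 11d + 6ρ ≤
sitesPerDir i)` (floor + level guards — the (R-b) V20 shape, LOCATED-UNGUARDED-LEVELS ∕ LOCATED-STUB1-FLOOR), the token holds for `κ := b9OfP F Mc ρ B₁` as soon as (i) `hP6`; (ii) the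
structural letters `M_h = L^{a′} ≥ M_h⁰`, `R ≥ R₀`, `L·M_h ∣ ρ`, `R·L·M_h ≤ ρ`, `L ≤ ρ`, `1 ≤ Mc`, `0 < B₃`, `a₀ ≤ a0OfP`, `8C_HB_He^{−δ_Hρ} ≤ θ_H`; (iii) `HCHART`: at every datum
of the token and every output `(u, A)` of n07-w3's door, the (159) objects with PER-LEVEL SIZE LETTERS `β₁ β₂ s′ σ t₁ v av` that are FUNCTIONS OF `(ε, δ, j)` ONLY; (iv) `HBUDGET`:
for all letters in the token's ranges and every level `j`, thresholds `t₂ t₃ t_∂` above the doors' floors with `t₁ + (t₂ + t_∂) + t₃ ≤ Cδ_j + θε_j + Qε_j²`.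

WHAT IS PROVED (sorry-free; no definition; axioms standard).  `exists_HV_of_flatH` (the kernel-formula binder `hHV` of every S6 door is inhabited — `HCHART`'s first component);
★★★ `datumGaugeSplitTopStepCoreG_of_prop6P_of_chart F N` (statement above); ★★★
`halvingStepTopCoreG_of_prop6P_of_chart F N` (∘ g3's closer: `HalvingStepTopCoreG F N Sup Adm B₃ a₀ a₁` modulo the same three inputs and the (162)–(166♭) smallness letters).
HONEST SCOPE.  Count-neutral ∀-introduction ∕ by-name composition (FILE 4 ∘ `LocalGaugeSplitOn.of_le`); [6] Prop. 6 is a HYPOTHESIS; `HCHART` (the chart lane's deliverable: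
k0-s1-w1∕w2, n07-w2, n07-w6∕w7, data n07-w5 — with the corrected current ∕ O₁ letter the lane owner lists as pending) and `HBUDGET` (the (162)–(166♭) arithmetic on the lane's
final letters) are DISPLAYED, NOT discharged, and their joint satisfiability at the record is NOT claimed here; nothing of [15]∕[6]∕[4] ANALYSIS asserted; the token is NOT
discharged unconditionally; `HalvingStepTop(Core)` ∕ `stub_prop8StepCoP13` ∕ K0⁷ ∕ K1⁹ NOT closed; N07 ∕ N05 NOT discharged; counts unmoved (typed 28∕28 · discharged 5∕27); one
finite 𝕋⁴ programme at fixed ε — the route closes the conditional finite-𝕋⁴ rung `BalabanLadder.UV` ONLY; the YM mass gap (Clay) is NOT proved by any of this; nothing continuum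
∕ ℝ⁴ ∕ OS.  No `sorry`, no `def`, no `instance`, no `notation`.

RELATED IN THE TREE, NOT DUPLICATED: FILE 4 `N07SplitClauseHeadOfProp6P` (the per-datum clause — CONSUMED); dag-n07-w4 g3 `N07LocalLettersCoreGuarded` (the token and its
downstream links `localLettersSplitCoreG_of_datumGaugeSplitCoreG`, `halvingStepTopCoreG_of_datumGaugeSplitCoreG` — CONSUMED ∕ downstream, not restated); n07-e modules 46∕47
(`Prop8RegSepTopStepG∕R`), k0-s1-w3 `…K0HalvingStepOfCoreFloor` (further downstream).

References: [15] (144) p. 300, (150)–(153) p. 301, (157)–(159) pp. 302–303, (162)–(166) pp. 303–304, (168) p. 304, Prop. 8 p. 304; [6] Prop. 6 (1.135)–(1.138) p. 99,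
(1.3)–(1.6) p. 77, (1.131) p. 99; [4] (2.1)–(2.4) p. 224, Cor. 2.8 (2.150)–(2.151) p. 249.
-/

set_option autoImplicit false

noncomputable section
open scoped BigOperators Matrix.Norms.L2Operator

namespace Summit.QuantumFields.YangMills.BalabanUVNodes.N07SplitClauseHeadKnit

open Literature.MathematicalPhysics.QuantumFieldTheory.Balaban1983to89
open Literature.MathematicalPhysics.QuantumFieldTheory.Balaban1983to89.Node00
open Literature.MathematicalPhysics.QuantumFieldTheory.Balaban1983to89.B15DeterminingSets
open Literature.MathematicalPhysics.QuantumFieldTheory.Balaban1983to89.B12RegularSpaces111 (gaugeU expI grad)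
open B15Eq112TorusCover (cover)
open B14DomainGeom (Pt Within)
open B14.Eq213MaximalDomains (side cubeExt)
open B5Eq117TorusCarriers (Mk)
open B5Eq118OneStroke (iterBlockOf)
open B5Prop12FieldsLattice (distSite)
open B8Eq131Cubes (sqLo sqHi box cube)
open B8LeafModelZd (ZdIdx)
open B11Eq115Space (levOf)
open B6SectADomainsV1 (Domains)
open B6SectAOperatorsV1 (BondIdx RE dsE QpE)
open Literature.MathematicalPhysics.QuantumFieldTheory.BalabanImbrieJaffe1984to88.BIJ85AxialPropagator411 (BondSpace)
open T4Continuum (T4Family)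
open T4AxialGaugeSmallField (castSite)
open B16Sect1Backgrounds (toMS)
open GaugeField (gaugeAct)
open MatrixLog (mlog)
open Summit.QuantumFields.YangMills.Theorems.K0FlatCubeOpsTextP (flatH)
open Summit.QuantumFields.YangMills.BalabanUVNodes.N07HalvingStepTopOfLocalLetters (Letters10On)
open Summit.QuantumFields.YangMills.BalabanUVNodes.N07LocalLettersSplitCore (LocalGaugeSplitOn)
open Summit.QuantumFields.YangMills.BalabanUVNodes.N07LocalLettersCoreGuarded (DatumGaugeSplitTopStepCoreG halvingStepTopCoreG_of_datumGaugeSplitCoreG)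
open Summit.QuantumFields.YangMills.BalabanUVNodes.N07SplitClauseHeadAtCubeDomains (localGaugeSplitOn_head159_cubeDomains_box)
open Summit.QuantumFields.YangMills.BalabanUVNodes.N07DatumGauge152Guarded (datumGauge152_REfiner153_of_prop6P_guarded numerics_cornerP_of_levelGuard)

/-- **THE EXTENSION `H_V` WITH THE `flatH` KERNEL FORMULA EXISTS** (the componentwise extension of k0-s1's real `flatH` to `M_N(ℂ)`-valued data — the inhabitant of the
kernel-formula binder `hHV` displayed by every S6 door and asked first in `HCHART`): `(H_V B)(b) := Σ_c (flatH P k D e_c)(b) • B(c)` is `ℂ`-linear in `B`.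
[cite: Balaban1985Variational, (157) p.302 («H … applied to each component»); Balaban1984PropagatorsII, (2.35) p.228] -/
theorem exists_HV_of_flatH {P : Params} (k : ℕ) (D : Domains P) (N' : ℕ) :
    ∃ HV : (BondIdx D → MatA N') →ₗ[ℂ] (PBond P 0 → MatA N'),
      ∀ (B : BondIdx D → MatA N') (b : PBond P 0), HV B b = ∑ c, ((flatH P k D (Pi.single c 1) b : ℝ) : ℂ) • B c := by
  classical
  refine ⟨{ toFun := fun B b => ∑ c, ((flatH P k D (Pi.single c 1) b : ℝ) : ℂ) • B c,
            map_add' := fun B B' => ?_, map_smul' := fun a B => ?_ }, fun _ _ => rfl⟩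
  · funext b
    simp only [Pi.add_apply, smul_add, Finset.sum_add_distrib]
  · funext b
    simp only [Pi.smul_apply, RingHom.id_apply, Finset.smul_sum, smul_comm a]

open scoped Classical in
/-- ★★★ **THE KNIT: THE GUARDED PER-DATUM TOKEN CLOSED MODULO [6] Prop. 6, THE CHART LANE's `HCHART`, AND THE BUDGET** (statement in the header).
[cite: Balaban1985Variational, (144) p.300, (150)–(153) p.301, (157)–(159) pp.302–303, (162)–(166) pp.303–304, (168) p.304, Prop. 8 p.304; Balaban1985RegularSpaces, Prop. 6 (1.135)–(1.138) p.99, (1.131) p.99; Balaban1984PropagatorsII, (2.1)–(2.4) p.224, Cor. 2.8 (2.150)–(2.151) p.249] -/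
theorem datumGaugeSplitTopStepCoreG_of_prop6P_of_chart (F : T4Family) (N : ℕ) [NeZero N] :
    ∃ (Mh₀ R₀ : ℕ) (CS BS CH δH BH : ℝ), 0 ≤ CS ∧ 0 < BS ∧ 0 ≤ CH ∧ 0 < δH ∧ 0 < BH ∧
    ∀ {B₁ c₁ : ℝ} (_ : 0 ≤ B₁) (_ : 0 < c₁) {ρ : ℕ}
      (_ : letI : CStarAlgebra (MatA N) := {}; B8.Prop6Printed 4 (F.L : ℝ) B₁ c₁ (fun i : ZdIdx 4 F.L => zdCubP (MatA N) F.L ρ i))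
      -- structural letters: grid cube `Mc`, block height `a′` (`M_h = L^{a′} ≥ M_h⁰`), `R ≥ R₀`, the collar `ρ` with `L·M_h ∣ ρ`, `R·L·M_h ≤ ρ`, `L ≤ ρ`
      {Mc Mh R a' : ℕ} (_ : 1 ≤ Mc) (_ : Mh = F.L ^ a') (_ : Mh₀ ≤ Mh) (_ : R₀ ≤ R) (_ : F.L * Mh ∣ ρ) (_ : R * (F.L * Mh) ≤ ρ) (hLρ : F.L ≤ ρ)
      -- the two constants of the plan's V20-G guard `c ≤ ν.M₁ ∧ k + c₀ ≤ F.m + K` and their side conditions, stated once (n07-w3 g7's two + the head's two)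
      {c c₀ : ℕ} (_ : (11 * 4 + 4 * ρ + Mc + 3) * F.L ≤ c) (_ : Mc + 11 * 4 + 6 * ρ ≤ 2 * F.L ^ c₀) (_ : F.m ≤ c₀) (_ : a' + 3 ≤ c₀)
      -- the token's letters, `0 < B₃`, `a₀ ≤ a0OfP`, the (163)-type letter `θ_H` of the `H` doors
      {B₃ C θ Q a₀ a₁ θH : ℝ} (_ : 0 < B₃) (_ : a₀ ≤ a0OfP F N Mc ρ B₁ c₁) (_ : 8 * CH * BH * Real.exp (-(δH * (ρ : ℝ))) ≤ θH)
      -- the chart side's PER-LEVEL SIZE LETTERS, functions of the letters `(ε, δ)` and the level only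
      (β₁ β₂ s' σ t₁ : (ℕ → ℝ) → (ℕ → ℝ) → ℕ → ℝ) (v av : (ℕ → ℝ) → (ℕ → ℝ) → ℕ → ℕ → ℝ)
      (_ : ∀ (K : ℕ) (ε δ : ℕ → ℝ) (j : ℕ), 0 ≤ β₁ ε δ j ∧ 0 ≤ β₂ ε δ j ∧ 0 ≤ s' ε δ j ∧ σ ε δ j ≤ 1 / 2 ∧ (∀ i, 0 ≤ v ε δ j i) ∧ (∀ i, 0 ≤ av ε δ j i) ∧
        (∀ i ≤ j, (((F.P K).d * ((sideP (F.P K) Mc ρ + 4 * ρ + 3) * (F.P K).L ^ (j - i)) : ℕ) : ℝ) * (v ε δ j i + av ε δ j i) ≤ σ ε δ j))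
      -- ★ HBUDGET: thresholds above the doors' floors summing below the token's threshold, at every level
      (_ : ∀ (K : ℕ) (ε δ : ℕ → ℝ) (j : ℕ), ∃ t₂ t₃ tD : ℝ,
        1 / 4 * ((sideP (F.P K) Mc ρ : ℕ) : ℝ) * max (4 * CH * BH * β₁ ε δ j) (θH * (β₂ ε δ j / ((sideP (F.P K) Mc ρ : ℕ) : ℝ))) < t₂ ∧
        1 / 4 * max (4 * CH * BH * s' ε δ j) (θH * s' ε δ j) < t₃ ∧ 2 * CS * BS * (4 * σ ε δ j) < tD ∧
        t₁ ε δ j + (t₂ + tD) + t₃ ≤ C * δ j + θ * ε j + Q * ε j ^ 2)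
      -- ★ HCHART: the chart lane's per-datum deliverable (see FILE 4), at every datum of the token and every output of n07-w3's door
      (_ : ∀ (ν : Stage7Numerics) (M : ℕ) (g : ℕ → ℝ) (K k : ℕ) (s : SeqOfRecord F ν M g K k), Sect2.SeqSeparated ν.M₁ s → 0 < ν.M₁ →
        c ≤ ν.M₁ ∧ k + c₀ ≤ F.m + K → 1 ≤ k →
        ∀ (ε δ : ℕ → ℝ),
        (∀ n, n ≤ k → 0 < δ n ∧ δ n ≤ a₁) → (∀ n, n < k → δ n ≤ 2 * δ (n + 1)) → (∀ n, n < k → δ (n + 1) ≤ 2 * δ n) →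
        (∀ n, n ≤ k → B₃ * δ n ≤ ε n ∧ ε n ≤ a₀) → (∀ n, n < k → ε n ≤ 2 * ε (n + 1)) → (∀ n, n < k → ε (n + 1) ≤ 2 * ε n) →
        ∀ W : MSField (F.P K) (SU N), Sect2.DataSmall7PTop (avOfRecord F N K) s.Ω (suppDomOfRecord F ν K s.Ω) k δ W →
        ∀ U : GaugeField (F.P K) 0 (SU N),
        (∀ n, n ≤ k → PlaqSmallOn (Sect2.omegaPlaqsTop s.Ω (suppDomOfRecord F ν K s.Ω) n) (ε n * (F.P K).eta n ^ 2) U) →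
        (∀ n, n ≤ k → Sect2.CoDivSmallOn (Sect2.omegaBondsTop s.Ω (suppDomOfRecord F ν K s.Ω) n) (ε n * (F.P K).eta n ^ 3) U) →
        AgreeOn (genSet s.Ω k) (avgFamily (avOfRecord F N K) U) W → IsCritOnFibre F N K (genSet s.Ω k) W U →
        ∀ (n : ℕ) (hk : K - n ≤ (F.P K).m + (F.P K).K), 1 ≤ K - n → K - n ≤ k → ∀ (idx : Pt (F.P K).d),
        ∀ {HVd : Domains (F.P K)} (_ : HVd = cubeDomains (F.P K) (cornerP (F.P K) Mc ρ idx) (sideP (F.P K) Mc ρ) ρ (K - n) hk)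
          (lo hi : ℕ → Pt (F.P K).d),
        lo 0 = (fun i => ((F.P K).L : ℤ) * (sqLo (F.P K).L (cornerP (F.P K) Mc ρ idx) ρ (K - n) 1 i - 1)) →
        hi 0 = (fun i => ((F.P K).L : ℤ) * (sqHi (F.P K).L (cornerP (F.P K) Mc ρ idx) (sideP (F.P K) Mc ρ) ρ (K - n) 1 i + 1) + (((F.P K).L : ℤ) - 1)) →
        (∀ j', 1 ≤ j' → lo j' = sqLo (F.P K).L (cornerP (F.P K) Mc ρ idx) ρ (K - n) j' - 1) →
        (∀ j', 1 ≤ j' → hi j' = sqHi (F.P K).L (cornerP (F.P K) Mc ρ idx) (sideP (F.P K) Mc ρ) ρ (K - n) j' + 1) →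
        ∃ HV : (BondIdx HVd → MatA N) →ₗ[ℂ] (PBond (F.P K) 0 → MatA N),
          (∀ (Bf : BondIdx HVd → MatA N) (b : PBond (F.P K) 0), HV Bf b = ∑ c, ((flatH (F.P K) (K - n) HVd (Pi.single c 1) b : ℝ) : ℂ) • Bf c) ∧
        ∀ (u : GaugeTransf (F.P K) 0 (SU N)) (A : PBond (F.P K) 0 → MatA N),
        (∀ b ∈ (Sect2.regionOfSet (F.P K) (cover (F.P K) '' box (F.P K).L (cornerP (F.P K) Mc ρ idx) (sideP (F.P K) Mc ρ) (K - n))).bonds,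
          gaugeU (fun x => ιSU N (u x)) (fun b' => ιSU N (U b')) b = expI ((F.P K).eta (K - n)) (A b)) →
        (∀ b ∈ (Sect2.regionOfSet (F.P K) (cover (F.P K) '' box (F.P K).L (cornerP (F.P K) Mc ρ idx) (sideP (F.P K) Mc ρ) (K - n))).bonds,
          ‖A b‖ < b9OfP F Mc ρ B₁ * ε (K - n)) →
        (∀ q ∈ (Sect2.regionOfSet (F.P K) (cover (F.P K) '' box (F.P K).L (cornerP (F.P K) Mc ρ idx) (sideP (F.P K) Mc ρ) (K - n))).dpairs,
          ‖grad ((F.P K).eta (K - n)) q.2.1 (fun y => A ⟨y, q.2.2⟩) q.1‖ < b9OfP F Mc ρ B₁ * ε (K - n)) →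
        (∀ b ∈ Sect2.bondsDeep (cover (F.P K) '' box (F.P K).L (cornerP (F.P K) Mc ρ idx) (sideP (F.P K) Mc ρ) (K - n)),
          ‖Sect2.codiffCurlA ((F.P K).eta (K - n)) A b.src b.dir‖ < b9OfP F Mc ρ B₁ * ε (K - n)) →
        (∀ b ∈ Sect2.bondsDeep (cover (F.P K) '' box (F.P K).L (cornerP (F.P K) Mc ρ idx) (sideP (F.P K) Mc ρ) (K - n)),
          ‖∑ ν' : Fin (F.P K).d, (((F.P K).eta (K - n) : ℝ) : ℂ)⁻¹ •
              (grad ((F.P K).eta (K - n)) ν' (fun y => A ⟨y, b.dir⟩) (b.src.unshift ν') - grad ((F.P K).eta (K - n)) ν' (fun y => A ⟨y, b.dir⟩) b.src)‖ <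
            b9OfP F Mc ρ B₁ * ε (K - n)) →
        (∀ D' : Domains (F.P K), LinearMap.ker (QpE D') ≤ LinearMap.ker (QpE HVd) → ∀ φ : MatA N →L[ℂ] ℂ,
          RE D' ((F.P K).eta (K - n))⁻¹ (dsE ((F.P K).eta (K - n))⁻¹ (WithLp.toLp 2 fun b => (φ (A b)).re : BondSpace (F.P K))) = 0 ∧
          RE D' ((F.P K).eta (K - n))⁻¹ (dsE ((F.P K).eta (K - n))⁻¹ (WithLp.toLp 2 fun b => (φ (A b)).im : BondSpace (F.P K))) = 0) →
        ∃ (xc : Pt (F.P K).d) (B B' : BondIdx HVd → MatA N) (A₁ : PBond (F.P K) 0 → MatA N)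
          (uL : GaugeTransf (F.P K) 0 (SU N)) (U₁ : GaugeField (F.P K) 0 (SU N)) (lam : (j : ℕ) → Site (F.P K) j → MatA N) (X : BondIdx HVd → MatA N),
          xc ∈ box (F.P K).L (cornerP (F.P K) Mc ρ idx) (sideP (F.P K) Mc ρ) (K - n) ∧
          (∀ c : BondIdx HVd, (c.1.1 : ℕ) = K - n →
            ‖B c‖ ≤ β₁ ε δ (K - n) * (distSite (Mk (F.P K) (c.1.1 : ℕ)) c.1.2.src (iterBlockOf (c.1.1 : ℕ) (cover (F.P K) xc)) + 1)) ∧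
          (∀ c : BondIdx HVd, (c.1.1 : ℕ) < K - n → ‖B c‖ ≤ β₂ ε δ (K - n)) ∧
          (∀ c, ‖B' c‖ ≤ s' ε δ (K - n)) ∧
          (∀ j' ≤ K - n, ∀ c : PBond (F.P K) j', c.src ∈ (castSite '' Set.Icc (lo j') (hi j') : Set (Site (F.P K) j')) →
            c.tgt ∈ (castSite '' Set.Icc (lo j') (hi j') : Set (Site (F.P K) j')) →
              dist1 (Averaging.iter (avOfRecord F N K) j' (gaugeAct uL U₁) c) ≤ v ε δ (K - n) j') ∧
          (∀ j' ≤ K - n, ∀ c : PBond (F.P K) j', c.src ∈ (castSite '' Set.Icc (lo j') (hi j') : Set (Site (F.P K) j')) →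
            c.tgt ∈ (castSite '' Set.Icc (lo j') (hi j') : Set (Site (F.P K) j')) → dist1 (Averaging.iter (avOfRecord F N K) j' U₁ c) ≤ av ε δ (K - n) j') ∧
          (∀ (j' : ℕ) (y : Site (F.P K) j'), ‖lam j' y‖ ≤ ‖mlog (((((toMS uL j' (castSite (lo j')))⁻¹ * toMS uL j' y)⁻¹ : SU N)) : MatA N)‖) ∧
          (∀ c : BondIdx HVd, X c = LatticeFieldCalculus.grad (((F.P K).L : ℝ) ^ (K - n) / ((F.P K).L : ℝ) ^ (c.1.1 : ℕ)) (lam c.1.1) c.1.2) ∧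
          Letters10On (cover (F.P K) '' box (F.P K).L (cornerP (F.P K) Mc ρ idx) (sideP (F.P K) Mc ρ) (K - n)) ((F.P K).eta (K - n)) (t₁ ε δ (K - n)) A₁ ∧
          (∀ b, A b - HV X b = A₁ b + HV B b - HV B' b)),
      DatumGaugeSplitTopStepCoreG F N (fun ν K Ω => suppDomOfRecord F ν K Ω) Mc ρ (fun ν _ _ K k _ => c ≤ ν.M₁ ∧ k + c₀ ≤ F.m + K)
        B₃ C θ Q (b9OfP F Mc ρ B₁) a₀ a₁ := by
  obtain ⟨Mh₀, R₀, CS, BS, CH, δH, BH, hCS, hBS, hCH, hδH, hBH, hmain⟩ := localGaugeSplitOn_head159_cubeDomains_box F N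
  refine ⟨Mh₀, R₀, CS, BS, CH, δH, BH, hCS, hBS, hCH, hδH, hBH, ?_⟩
  intro B₁ c₁ hB₁ hc₁ ρ hP6 Mc Mh R a' hMc hMha hMh hR hdvd hRρ hLρ c c₀ hc hc₀ hmc₀ hac₀ B₃ C θ Q a₀ a₁ θH hB₃ ha₀ h163 β₁ β₂ s' σ t₁ v av
    hletters hbudget hchart ν M g K k s hsep hM₁ hadm hk ε δ hδ hcompδ hcompδ' hε hεcomp hεcomp' W h7 U h17 h19 hfib hcrit j hj hjk a hmeet
  -- the level guard with `F.m ≤ c₀` puts every datum level below `K`: write it as `K − n`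
  have hkK : k ≤ K := by have := hadm.2; omega
  obtain ⟨n, rfl⟩ : ∃ n, j = K - n := ⟨K - j, by omega⟩
  have hk1 : 1 ≤ K - n := hj
  have hkP : K - n ≤ (F.P K).m + (F.P K).K := by
    have : (F.P K).m + (F.P K).K = F.m + K := rfl
    omega
  have hLρ' : (F.P K).L ≤ ρ := hLρ
  -- the letters' ranges
  have hε' : ∀ m, m ≤ k → 0 < ε m ∧ ε m ≤ a₀ := fun m hm => ⟨lt_of_lt_of_le (mul_pos hB₃ (hδ m hm).1) (hε m hm).1, (hε m hm).2⟩
  obtain ⟨hβ₁, hβ₂, hs', hσ, hv0, ha0, hDσ⟩ := hletters K ε δ (K - n)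
  obtain ⟨t₂, t₃, tD, ht₂, ht₃, htD, hsum⟩ := hbudget K ε δ (K - n)
  -- S3's gauge at this datum under the V20-G guard (n07-w3 g7, by name) and the datum's numerics from the level guard
  obtain ⟨u, A, he, hA, hdA, hcd, hlap, h6⟩ := datumGauge152_REfiner153_of_prop6P_guarded (F := F) (N := N) hB₁ hc₁ hP6 hMc hc hc₀ ν g K k hLρ' s hsep hadm ε ha₀
    hε' hεcomp U h17 h19 hk1 hjk a hmeet
  obtain ⟨ha, hM, hper, hinj⟩ := numerics_cornerP_of_levelGuard F hk1 hjk hadm.2 hMha (by omega) hLρ' hdvd hc₀ a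
  have hρpos : 0 < ρ := lt_of_lt_of_le (F.P K).L_pos hLρ'
  have hM1 : 1 ≤ sideP (F.P K) Mc ρ := by have := le_sideP (P := F.P K) Mc hρpos; omega
  -- the canonical boxes of the datum's tower
  set lo : ℕ → Pt (F.P K).d := fun j' => if j' = 0 then (fun i => ((F.P K).L : ℤ) * (sqLo (F.P K).L (cornerP (F.P K) Mc ρ a) ρ (K - n) 1 i - 1))
    else sqLo (F.P K).L (cornerP (F.P K) Mc ρ a) ρ (K - n) j' - 1 with hlo
  set hi : ℕ → Pt (F.P K).d := fun j' => if j' = 0 then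
      (fun i => ((F.P K).L : ℤ) * (sqHi (F.P K).L (cornerP (F.P K) Mc ρ a) (sideP (F.P K) Mc ρ) ρ (K - n) 1 i + 1) + (((F.P K).L : ℤ) - 1))
    else sqHi (F.P K).L (cornerP (F.P K) Mc ρ a) (sideP (F.P K) Mc ρ) ρ (K - n) j' + 1 with hhi
  have hlo0 : lo 0 = fun i => ((F.P K).L : ℤ) * (sqLo (F.P K).L (cornerP (F.P K) Mc ρ a) ρ (K - n) 1 i - 1) := by simp [hlo]
  have hhi0 : hi 0 = fun i => ((F.P K).L : ℤ) * (sqHi (F.P K).L (cornerP (F.P K) Mc ρ a) (sideP (F.P K) Mc ρ) ρ (K - n) 1 i + 1) + (((F.P K).L : ℤ) - 1) := by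
    simp [hhi]
  have hloj : ∀ j', 1 ≤ j' → lo j' = sqLo (F.P K).L (cornerP (F.P K) Mc ρ a) ρ (K - n) j' - 1 := fun j' hj' => by
    simp [hlo, Nat.one_le_iff_ne_zero.mp hj']
  have hhij : ∀ j', 1 ≤ j' → hi j' = sqHi (F.P K).L (cornerP (F.P K) Mc ρ a) (sideP (F.P K) Mc ρ) ρ (K - n) j' + 1 := fun j' hj' => by
    simp [hhi, Nat.one_le_iff_ne_zero.mp hj']
  -- the chart side at this datum and gauge
  obtain ⟨HV, hHV, hch⟩ := hchart ν M g K k s hsep hM₁ hadm hk ε δ hδ hcompδ hcompδ' hε hεcomp hεcomp' W h7 U h17 h19 hfib hcrit n hkP hk1 hjk a rfl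
    lo hi hlo0 hhi0 hloj hhij
  obtain ⟨xc, B, B', A₁, uL, U₁, lam, X, hxc, hX₁, hX₂, hB', hv, hav, hlam, hX, h₁, h159⟩ := hch u A he hA hdA hcd hlap (fun D' hD' φ => h6 hkP D' hD' φ)
  -- FILE 3 at this datum, then down to the token's threshold
  have hclause := hmain n K hk1 (by omega) hkP hMha hMh hR (by omega) hM1 hdvd ha hM hper hRρ hLρ hinj hHV hxc hβ₁ hβ₂ h163 hX₁ hX₂ hs' hB'
    hlo0 hhi0 hloj hhij uL U₁ (v ε δ (K - n)) (av ε δ (K - n)) hv0 ha0 hσ hDσ hv hav lam hlam hX u he hA hdA h₁ h159 ht₂ ht₃ htD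
  exact hclause.of_le le_rfl hsum

/-- ★★★ **THE ONE-STEP IMPROVEMENT AT THE CORE (GUARDED, `HalvingStepTopCoreG`) CLOSED MODULO [6] Prop. 6, `HCHART`, `HBUDGET` AND THE (162)–(166♭) SMALLNESS LETTERS**:
the knit composed with dag-n07-w4 g3's closer `halvingStepTopCoreG_of_datumGaugeSplitCoreG` (`4C ≤ B₃`, `16θ ≤ 1`, `0 ≤ Q`, `(16Q + 1024κ²)a₀ ≤ 1`, `32κa₀ ≤ 1`,
`κ := b9OfP F Mc ρ B₁ > 0`) — downstream: k0-s1-w3's Core⇒Top link, n07-e module 47 `Prop8RegSepTopStepG`, stub 1.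
[cite: Balaban1985Variational, (162)–(166) pp.303–304, (168) p.304, Prop. 8 p.304; Balaban1985RegularSpaces, Prop. 6 p.99, (1.7)–(1.9) p.77, (1.54) p.85] -/
theorem halvingStepTopCoreG_of_prop6P_of_chart (F : T4Family) (N : ℕ) [NeZero N] :
    ∃ (Mh₀ R₀ : ℕ) (CS BS CH δH BH : ℝ), 0 ≤ CS ∧ 0 < BS ∧ 0 ≤ CH ∧ 0 < δH ∧ 0 < BH ∧
    ∀ {B₁ c₁ : ℝ} (_ : 0 ≤ B₁) (_ : 0 < c₁) {ρ : ℕ}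
      (_ : letI : CStarAlgebra (MatA N) := {}; B8.Prop6Printed 4 (F.L : ℝ) B₁ c₁ (fun i : ZdIdx 4 F.L => zdCubP (MatA N) F.L ρ i))
      -- structural letters: grid cube `Mc`, block height `a′` (`M_h = L^{a′} ≥ M_h⁰`), `R ≥ R₀`, the collar `ρ` with `L·M_h ∣ ρ`, `R·L·M_h ≤ ρ`, `L ≤ ρ`
      {Mc Mh R a' : ℕ} (_ : 1 ≤ Mc) (_ : Mh = F.L ^ a') (_ : Mh₀ ≤ Mh) (_ : R₀ ≤ R) (_ : F.L * Mh ∣ ρ) (_ : R * (F.L * Mh) ≤ ρ) (hLρ : F.L ≤ ρ)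
      -- the two constants of the plan's V20-G guard `c ≤ ν.M₁ ∧ k + c₀ ≤ F.m + K` and their side conditions, stated once (n07-w3 g7's two + the head's two)
      {c c₀ : ℕ} (_ : (11 * 4 + 4 * ρ + Mc + 3) * F.L ≤ c) (_ : Mc + 11 * 4 + 6 * ρ ≤ 2 * F.L ^ c₀) (_ : F.m ≤ c₀) (_ : a' + 3 ≤ c₀)
      -- the token's letters, `0 < B₃`, `a₀ ≤ a0OfP`, the (163)-type letter `θ_H` of the `H` doors
      {B₃ C θ Q a₀ a₁ θH : ℝ} (_ : 0 < B₃) (_ : a₀ ≤ a0OfP F N Mc ρ B₁ c₁) (_ : 8 * CH * BH * Real.exp (-(δH * (ρ : ℝ))) ≤ θH)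
      -- the (162)–(166♭) smallness letters of the R0′ closers (`halvingStepTopCoreG_of_localLettersSplitCoreG`), `κ := b9OfP F Mc ρ B₁`
      (_ : 4 * C ≤ B₃) (_ : 16 * θ ≤ 1) (_ : 0 ≤ Q) (_ : (16 * Q + 1024 * b9OfP F Mc ρ B₁ ^ 2) * a₀ ≤ 1) (_ : 32 * b9OfP F Mc ρ B₁ * a₀ ≤ 1)
      -- the chart side's PER-LEVEL SIZE LETTERS, functions of the letters `(ε, δ)` and the level only
      (β₁ β₂ s' σ t₁ : (ℕ → ℝ) → (ℕ → ℝ) → ℕ → ℝ) (v av : (ℕ → ℝ) → (ℕ → ℝ) → ℕ → ℕ → ℝ)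
      (_ : ∀ (K : ℕ) (ε δ : ℕ → ℝ) (j : ℕ), 0 ≤ β₁ ε δ j ∧ 0 ≤ β₂ ε δ j ∧ 0 ≤ s' ε δ j ∧ σ ε δ j ≤ 1 / 2 ∧ (∀ i, 0 ≤ v ε δ j i) ∧ (∀ i, 0 ≤ av ε δ j i) ∧
        (∀ i ≤ j, (((F.P K).d * ((sideP (F.P K) Mc ρ + 4 * ρ + 3) * (F.P K).L ^ (j - i)) : ℕ) : ℝ) * (v ε δ j i + av ε δ j i) ≤ σ ε δ j))
      -- ★ HBUDGET: thresholds above the doors' floors summing below the token's threshold, at every level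
      (_ : ∀ (K : ℕ) (ε δ : ℕ → ℝ) (j : ℕ), ∃ t₂ t₃ tD : ℝ,
        1 / 4 * ((sideP (F.P K) Mc ρ : ℕ) : ℝ) * max (4 * CH * BH * β₁ ε δ j) (θH * (β₂ ε δ j / ((sideP (F.P K) Mc ρ : ℕ) : ℝ))) < t₂ ∧
        1 / 4 * max (4 * CH * BH * s' ε δ j) (θH * s' ε δ j) < t₃ ∧ 2 * CS * BS * (4 * σ ε δ j) < tD ∧
        t₁ ε δ j + (t₂ + tD) + t₃ ≤ C * δ j + θ * ε j + Q * ε j ^ 2)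
      -- ★ HCHART: the chart lane's per-datum deliverable (see FILE 4), at every datum of the token and every output of n07-w3's door
      (_ : ∀ (ν : Stage7Numerics) (M : ℕ) (g : ℕ → ℝ) (K k : ℕ) (s : SeqOfRecord F ν M g K k), Sect2.SeqSeparated ν.M₁ s → 0 < ν.M₁ →
        c ≤ ν.M₁ ∧ k + c₀ ≤ F.m + K → 1 ≤ k →
        ∀ (ε δ : ℕ → ℝ),
        (∀ n, n ≤ k → 0 < δ n ∧ δ n ≤ a₁) → (∀ n, n < k → δ n ≤ 2 * δ (n + 1)) → (∀ n, n < k → δ (n + 1) ≤ 2 * δ n) →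
        (∀ n, n ≤ k → B₃ * δ n ≤ ε n ∧ ε n ≤ a₀) → (∀ n, n < k → ε n ≤ 2 * ε (n + 1)) → (∀ n, n < k → ε (n + 1) ≤ 2 * ε n) →
        ∀ W : MSField (F.P K) (SU N), Sect2.DataSmall7PTop (avOfRecord F N K) s.Ω (suppDomOfRecord F ν K s.Ω) k δ W →
        ∀ U : GaugeField (F.P K) 0 (SU N),
        (∀ n, n ≤ k → PlaqSmallOn (Sect2.omegaPlaqsTop s.Ω (suppDomOfRecord F ν K s.Ω) n) (ε n * (F.P K).eta n ^ 2) U) →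
        (∀ n, n ≤ k → Sect2.CoDivSmallOn (Sect2.omegaBondsTop s.Ω (suppDomOfRecord F ν K s.Ω) n) (ε n * (F.P K).eta n ^ 3) U) →
        AgreeOn (genSet s.Ω k) (avgFamily (avOfRecord F N K) U) W → IsCritOnFibre F N K (genSet s.Ω k) W U →
        ∀ (n : ℕ) (hk : K - n ≤ (F.P K).m + (F.P K).K), 1 ≤ K - n → K - n ≤ k → ∀ (idx : Pt (F.P K).d),
        ∀ {HVd : Domains (F.P K)} (_ : HVd = cubeDomains (F.P K) (cornerP (F.P K) Mc ρ idx) (sideP (F.P K) Mc ρ) ρ (K - n) hk)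
          (lo hi : ℕ → Pt (F.P K).d),
        lo 0 = (fun i => ((F.P K).L : ℤ) * (sqLo (F.P K).L (cornerP (F.P K) Mc ρ idx) ρ (K - n) 1 i - 1)) →
        hi 0 = (fun i => ((F.P K).L : ℤ) * (sqHi (F.P K).L (cornerP (F.P K) Mc ρ idx) (sideP (F.P K) Mc ρ) ρ (K - n) 1 i + 1) + (((F.P K).L : ℤ) - 1)) →
        (∀ j', 1 ≤ j' → lo j' = sqLo (F.P K).L (cornerP (F.P K) Mc ρ idx) ρ (K - n) j' - 1) →
        (∀ j', 1 ≤ j' → hi j' = sqHi (F.P K).L (cornerP (F.P K) Mc ρ idx) (sideP (F.P K) Mc ρ) ρ (K - n) j' + 1) →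
        ∃ HV : (BondIdx HVd → MatA N) →ₗ[ℂ] (PBond (F.P K) 0 → MatA N),
          (∀ (Bf : BondIdx HVd → MatA N) (b : PBond (F.P K) 0), HV Bf b = ∑ c, ((flatH (F.P K) (K - n) HVd (Pi.single c 1) b : ℝ) : ℂ) • Bf c) ∧
        ∀ (u : GaugeTransf (F.P K) 0 (SU N)) (A : PBond (F.P K) 0 → MatA N),
        (∀ b ∈ (Sect2.regionOfSet (F.P K) (cover (F.P K) '' box (F.P K).L (cornerP (F.P K) Mc ρ idx) (sideP (F.P K) Mc ρ) (K - n))).bonds,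
          gaugeU (fun x => ιSU N (u x)) (fun b' => ιSU N (U b')) b = expI ((F.P K).eta (K - n)) (A b)) →
        (∀ b ∈ (Sect2.regionOfSet (F.P K) (cover (F.P K) '' box (F.P K).L (cornerP (F.P K) Mc ρ idx) (sideP (F.P K) Mc ρ) (K - n))).bonds,
          ‖A b‖ < b9OfP F Mc ρ B₁ * ε (K - n)) →
        (∀ q ∈ (Sect2.regionOfSet (F.P K) (cover (F.P K) '' box (F.P K).L (cornerP (F.P K) Mc ρ idx) (sideP (F.P K) Mc ρ) (K - n))).dpairs,
          ‖grad ((F.P K).eta (K - n)) q.2.1 (fun y => A ⟨y, q.2.2⟩) q.1‖ < b9OfP F Mc ρ B₁ * ε (K - n)) →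
        (∀ b ∈ Sect2.bondsDeep (cover (F.P K) '' box (F.P K).L (cornerP (F.P K) Mc ρ idx) (sideP (F.P K) Mc ρ) (K - n)),
          ‖Sect2.codiffCurlA ((F.P K).eta (K - n)) A b.src b.dir‖ < b9OfP F Mc ρ B₁ * ε (K - n)) →
        (∀ b ∈ Sect2.bondsDeep (cover (F.P K) '' box (F.P K).L (cornerP (F.P K) Mc ρ idx) (sideP (F.P K) Mc ρ) (K - n)),
          ‖∑ ν' : Fin (F.P K).d, (((F.P K).eta (K - n) : ℝ) : ℂ)⁻¹ •
              (grad ((F.P K).eta (K - n)) ν' (fun y => A ⟨y, b.dir⟩) (b.src.unshift ν') - grad ((F.P K).eta (K - n)) ν' (fun y => A ⟨y, b.dir⟩) b.src)‖ <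
            b9OfP F Mc ρ B₁ * ε (K - n)) →
        (∀ D' : Domains (F.P K), LinearMap.ker (QpE D') ≤ LinearMap.ker (QpE HVd) → ∀ φ : MatA N →L[ℂ] ℂ,
          RE D' ((F.P K).eta (K - n))⁻¹ (dsE ((F.P K).eta (K - n))⁻¹ (WithLp.toLp 2 fun b => (φ (A b)).re : BondSpace (F.P K))) = 0 ∧
          RE D' ((F.P K).eta (K - n))⁻¹ (dsE ((F.P K).eta (K - n))⁻¹ (WithLp.toLp 2 fun b => (φ (A b)).im : BondSpace (F.P K))) = 0) →
        ∃ (xc : Pt (F.P K).d) (B B' : BondIdx HVd → MatA N) (A₁ : PBond (F.P K) 0 → MatA N)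
          (uL : GaugeTransf (F.P K) 0 (SU N)) (U₁ : GaugeField (F.P K) 0 (SU N)) (lam : (j : ℕ) → Site (F.P K) j → MatA N) (X : BondIdx HVd → MatA N),
          xc ∈ box (F.P K).L (cornerP (F.P K) Mc ρ idx) (sideP (F.P K) Mc ρ) (K - n) ∧
          (∀ c : BondIdx HVd, (c.1.1 : ℕ) = K - n →
            ‖B c‖ ≤ β₁ ε δ (K - n) * (distSite (Mk (F.P K) (c.1.1 : ℕ)) c.1.2.src (iterBlockOf (c.1.1 : ℕ) (cover (F.P K) xc)) + 1)) ∧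
          (∀ c : BondIdx HVd, (c.1.1 : ℕ) < K - n → ‖B c‖ ≤ β₂ ε δ (K - n)) ∧
          (∀ c, ‖B' c‖ ≤ s' ε δ (K - n)) ∧
          (∀ j' ≤ K - n, ∀ c : PBond (F.P K) j', c.src ∈ (castSite '' Set.Icc (lo j') (hi j') : Set (Site (F.P K) j')) →
            c.tgt ∈ (castSite '' Set.Icc (lo j') (hi j') : Set (Site (F.P K) j')) →
              dist1 (Averaging.iter (avOfRecord F N K) j' (gaugeAct uL U₁) c) ≤ v ε δ (K - n) j') ∧
          (∀ j' ≤ K - n, ∀ c : PBond (F.P K) j', c.src ∈ (castSite '' Set.Icc (lo j') (hi j') : Set (Site (F.P K) j')) →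
            c.tgt ∈ (castSite '' Set.Icc (lo j') (hi j') : Set (Site (F.P K) j')) → dist1 (Averaging.iter (avOfRecord F N K) j' U₁ c) ≤ av ε δ (K - n) j') ∧
          (∀ (j' : ℕ) (y : Site (F.P K) j'), ‖lam j' y‖ ≤ ‖mlog (((((toMS uL j' (castSite (lo j')))⁻¹ * toMS uL j' y)⁻¹ : SU N)) : MatA N)‖) ∧
          (∀ c : BondIdx HVd, X c = LatticeFieldCalculus.grad (((F.P K).L : ℝ) ^ (K - n) / ((F.P K).L : ℝ) ^ (c.1.1 : ℕ)) (lam c.1.1) c.1.2) ∧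
          Letters10On (cover (F.P K) '' box (F.P K).L (cornerP (F.P K) Mc ρ idx) (sideP (F.P K) Mc ρ) (K - n)) ((F.P K).eta (K - n)) (t₁ ε δ (K - n)) A₁ ∧
          (∀ b, A b - HV X b = A₁ b + HV B b - HV B' b)),
      HalvingStepTopCoreG F N (fun ν K Ω => suppDomOfRecord F ν K Ω) (fun ν _ _ K k _ => c ≤ ν.M₁ ∧ k + c₀ ≤ F.m + K) B₃ a₀ a₁ := by
  obtain ⟨Mh₀, R₀, CS, BS, CH, δH, BH, hCS, hBS, hCH, hδH, hBH, hmain⟩ := datumGaugeSplitTopStepCoreG_of_prop6P_of_chart F N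
  refine ⟨Mh₀, R₀, CS, BS, CH, δH, BH, hCS, hBS, hCH, hδH, hBH, ?_⟩
  intro B₁ c₁ hB₁ hc₁ ρ hP6 Mc Mh R a' hMc hMha hMh hR hdvd hRρ hLρ c c₀ hc hc₀ hmc₀ hac₀ B₃ C θ Q a₀ a₁ θH hB₃ ha₀ h163 hC hθ hQ ha hκa β₁ β₂ s' σ t₁ v av
    hletters hbudget hchart
  exact halvingStepTopCoreG_of_datumGaugeSplitCoreG hMc hLρ
    (hmain hB₁ hc₁ hP6 hMc hMha hMh hR hdvd hRρ hLρ hc hc₀ hmc₀ hac₀ hB₃ ha₀ h163 β₁ β₂ s' σ t₁ v av hletters hbudget hchart)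
    hB₃.le hC hθ hQ (b9OfP_pos (F := F) Mc ρ hB₁).le ha hκa

end Summit.QuantumFields.YangMills.BalabanUVNodes.N07SplitClauseHeadKnit

end
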